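import Summits.QuantumFields.YangMills.Theorems.AllWindowsColdBoxBoxHighLineCaccioppoliIdentity
import Summits.QuantumFields.YangMills.Theorems.AllWindowsColdBoxBoxHighLineHodgePoincareStub

/-!
# LINE-20 U1 / LINE-19 S3, structure lemma T-U1.0: the ROWS of the Hodge precision matrix `hodgeQ`

Planner ym-idea-2 g17's STUB-PLAN-U1 §0 (crux `AllWindowsColdBox.BoxWindowHighSU2213` ⟨stmt-QuantumFields-24336⟩, parent ⟨24004⟩ / low
⟨24335⟩): before any decay estimate for `hodgeQ⁻¹` (stubs S3b `LandauKernelDecay`, U1b, U1c) one needs the exact row structure of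
`hodgeQ H = Qmat + Σ_{x interior} g_x g_xᵀ = d₁ᵀd₁ + d₀ᴵ(d₀ᴵ)ᵀ`.  Writing `ū = glue 0 w` for the zero extension of a free configuration `w` to
all edges of `ℤ⁴` and `e = (x, μ)` for a free (cold-box) edge:

* `landauCoeff_dotProduct_eq_circ` — `λ_p · w` is the circulation of `ū` around `p`;
* **`hodgeQ_mulVec_apply`** (every free edge): `(hodgeQ w)(e) = Σ_{ν} [μ<ν](circ_{(x;μ,ν)} − circ_{(x−e_ν;μ,ν)})(ū)
  + Σ_{ν} [ν<μ](circ_{(x−e_ν;ν,μ)} − circ_{(x;ν,μ)})(ū) + 𝟙[x+e_μ ∈ I]·div ū(x+e_μ) − 𝟙[x ∈ I]·div ū(x)`, `div ū(y) = Σ_i (ū(y−e_i,i) − ū(y,i))`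
  (the six plaquettes through `e` and the two endpoint gauge modes);
* **`hodgeQ_mulVec_apply_bulk`** (both endpoints interior): the mixed terms cancel (lattice Weitzenböck identity) and
  `(hodgeQ w)(e) = 8·w(e) − Σ_ν (ū(x+e_ν, μ) + ū(x−e_ν, μ))` — the COMPONENTWISE 8-neighbour scalar Laplacian row with zero extension; hence every
  component of a `hodgeQ`-harmonic field is a discrete harmonic function at bulk edges (the entry point of the scalar toolbox: difference
  estimates, Harnack, reflection).  At a face-tangential edge (an endpoint on the frozen wall) the missing divergence term leaves the mixed curl
  terms uncancelled and drops the longitudinal second difference — `hodgeQ` is NOT the componentwise Dirichlet Laplacian there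
  (equivalently `hodgeQ = Δ_D − Σ_{x ∈ ∂box} g_x g_xᵀ`).

Everything proved; no definitions; standard axioms.  HONEST LABEL: bookkeeping toward the kernel stubs of two critic-stamped DRAFT lines on the
R2ξ″ crux; no stub is proved by name here, no crux, rung or summit is proved; the Yang–Mills mass gap is NOT proved by this file.
-/

set_option autoImplicit false

noncomputable section

namespace Summit.QuantumFields.YangMills.Theorems.AllWindowsColdBoxBoxHighLine

open Finset Matrix
open Literature.Probability.LatticeModels (Site mem_halfOpenBox halfOpenBox)
open Literature.MathematicalPhysics.QuantumFieldTheory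
open Literature.MathematicalPhysics.QuantumFieldTheory.LatticeMaxwell
open Literature.MathematicalPhysics.QuantumFieldTheory.AxialGauge
open Summit.QuantumFields.YangMills.Theorems.WeakCouplingRates
open HodgePoincare

variable {H : ℕ}

/-! ## Circulation coefficients and the zero extension -/

/-- `λ_p · w = circ_p(ū)`: the coefficient vector of a plaquette pairs with a free configuration to the circulation of its zero extension. -/
theorem landauCoeff_dotProduct_eq_circ (w : LandauFree H → ℝ) (p : Plaq 4) :
    landauCoeff H p ⬝ᵥ w = sCirc (glue (pin := landauPin H) dirCorner (2 * H + 3) 0 w) p := by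
  have hz : glue (pin := landauPin H) dirCorner (2 * H + 3) (0 : Literature.MathematicalPhysics.QuantumLattice.ZdEdge 4 → ℝ)
      (0 : LandauFree H → ℝ) = 0 := by
    funext e
    unfold glue
    split_ifs <;> rfl
  rw [landauCoeff, sCirc_glue, bterm, hz]
  simp [sCirc]

/-- The coefficient of the free edge `e` in `λ_p` is the explicit indicator combination `coeffAux e p`. -/
theorem landauCoeff_apply (p : Plaq 4) (e : LandauFree H) : landauCoeff H p e = coeffAux e.1.1 p := rfl

/-! ## The plaquette part of a row as a box sum -/

/-- The plaquette part of the row `e` of `hodgeQ`, as a sum over base points `z ∈ [-2, 2H+2]⁴` and ordered direction pairs `i < j`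
of `coeffAux e (z;i,j) · circ_{(z;i,j)}(ū)`. -/
theorem sum_hodgePlaqs_row_eq_boxSum (w : LandauFree H → ℝ) (e : LandauFree H)
    (u : Literature.MathematicalPhysics.QuantumLattice.ZdEdge 4 → ℝ) (hu : u = glue (pin := landauPin H) dirCorner (2 * H + 3) 0 w) :
    ∑ p ∈ hodgePlaqs H, landauCoeff H p e * (landauCoeff H p ⬝ᵥ w) =
      ∑ z ∈ Fintype.piFinset (fun _ : Fin 4 => Finset.Icc (-2 : ℤ) (((2 * H : ℕ) : ℤ) + 2)), ∑ i : Fin 4, ∑ j : Fin 4,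
        (if i < j then
          (((if e.1.1 = (z, i) then (1 : ℝ) else 0) + (if e.1.1 = (z + Pi.single i 1, j) then 1 else 0) -
              (if e.1.1 = (z + Pi.single j 1, i) then 1 else 0) - (if e.1.1 = (z, j) then 1 else 0)) *
            (u (z, i) + u (z + Pi.single i 1, j) - u (z + Pi.single j 1, i) - u (z, j)))
        else 0) := by
  have hsupp : ∀ x i, u (x, i) ≠ 0 → (∀ k, 0 ≤ x k ∧ x k ≤ ((2 * H : ℕ) : ℤ)) ∧ x i + 1 ≤ ((2 * H : ℕ) : ℤ) := by
    intro x i h; rw [hu] at h; exact glue_supp H w x i h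
  have hterm : ∀ p : Plaq 4, landauCoeff H p e * (landauCoeff H p ⬝ᵥ w) = coeffAux e.1.1 p * sCirc u p := by
    intro p; rw [landauCoeff_apply, landauCoeff_dotProduct_eq_circ, ← hu]
  simp only [hterm]
  have hT : ∑ z ∈ Fintype.piFinset (fun _ : Fin 4 => Finset.Icc (-2 : ℤ) (((2 * H : ℕ) : ℤ) + 2)), ∑ i : Fin 4, ∑ j : Fin 4,
      (if i < j then
          (((if e.1.1 = (z, i) then (1 : ℝ) else 0) + (if e.1.1 = (z + Pi.single i 1, j) then 1 else 0) -
              (if e.1.1 = (z + Pi.single j 1, i) then 1 else 0) - (if e.1.1 = (z, j) then 1 else 0)) *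
            (u (z, i) + u (z + Pi.single i 1, j) - u (z + Pi.single j 1, i) - u (z, j)))
        else 0) =
      ∑ q ∈ (Fintype.piFinset (fun _ : Fin 4 => Finset.Icc (-2 : ℤ) (((2 * H : ℕ) : ℤ) + 2)) ×ˢ
        ((Finset.univ : Finset (Fin 4)) ×ˢ (Finset.univ : Finset (Fin 4)))).filter (fun q => q.2.1 < q.2.2),
        coeffAux e.1.1 q * sCirc u q := by
    rw [Finset.sum_filter, Finset.sum_product]
    refine Finset.sum_congr rfl fun z _ => ?_
    rw [Finset.sum_product]
    refine Finset.sum_congr rfl fun i _ => Finset.sum_congr rfl fun j _ => ?_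
    simp only [sCirc, coeffAux]
  rw [hT, hodgePlaqs]
  symm
  refine sum_eq_sum_of_support fun q hq => ?_
  have hne : sCirc u q ≠ 0 := fun h => hq (by rw [h]; ring)
  have hbase := base_bounds_of_sCirc_ne_zero H u hsupp q hne
  rw [Finset.mem_filter, Finset.mem_product, Finset.mem_product, mem_box, mem_image_shift_iff]
  have hei := HodgePoincare.single_one_apply_bounds q.2.1
  have hej := HodgePoincare.single_one_apply_bounds q.2.2
  constructor
  · rintro ⟨⟨-, -, -⟩, hlt⟩
    refine ⟨hlt, fun k => by have := hbase k; constructor <;> omega, fun k => ?_⟩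
    have h1 := hbase k
    have h2 := HodgePoincare.single_add_single_apply_bounds (ne_of_lt hlt) k
    simp only [Pi.add_apply] at h2 ⊢
    omega
  · rintro ⟨hlt, -, -⟩
    refine ⟨⟨fun k => ?_, Finset.mem_univ _, Finset.mem_univ _⟩, hlt⟩
    have := hbase k; push_cast; constructor <;> omega

/-! ## Collapsing the box sum to the six plaquettes through `e = (x, μ)` -/

/-- The indicator–weighted box sum collapses to the six plaquettes through the edge `(x, μ)`:
two per transverse direction `ν ≠ μ`, based at `x` and at `x − e_ν`, with the signs of `coeffAux`. -/
theorem boxSum_coeffAux_collapse (B : Finset (Site 4)) (x : Site 4) (μ : Fin 4) (hx : x ∈ B)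
    (hxν : ∀ ν : Fin 4, x - Pi.single ν 1 ∈ B) (S : Site 4 → Fin 4 → Fin 4 → ℝ) :
    ∑ z ∈ B, ∑ i : Fin 4, ∑ j : Fin 4,
        (if i < j then
          (((if (x, μ) = (z, i) then (1 : ℝ) else 0) + (if (x, μ) = (z + Pi.single i 1, j) then 1 else 0) -
              (if (x, μ) = (z + Pi.single j 1, i) then 1 else 0) - (if (x, μ) = (z, j) then 1 else 0)) * S z i j)
        else 0) =
      (∑ ν : Fin 4, if μ < ν then S x μ ν - S (x - Pi.single ν 1) μ ν else 0) +
        ∑ ν : Fin 4, if ν < μ then S (x - Pi.single ν 1) ν μ - S x ν μ else 0 := by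
  -- split the summand into the four indicator pieces
  have hsplit : ∀ z i j, (if i < j then
          (((if (x, μ) = (z, i) then (1 : ℝ) else 0) + (if (x, μ) = (z + Pi.single i 1, j) then 1 else 0) -
              (if (x, μ) = (z + Pi.single j 1, i) then 1 else 0) - (if (x, μ) = (z, j) then 1 else 0)) * S z i j)
        else 0) =
      (if i < j ∧ (x, μ) = (z, i) then S z i j else 0) + (if i < j ∧ (x, μ) = (z + Pi.single i 1, j) then S z i j else 0) -
        (if i < j ∧ (x, μ) = (z + Pi.single j 1, i) then S z i j else 0) - (if i < j ∧ (x, μ) = (z, j) then S z i j else 0) := by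
    intro z i j
    by_cases hij : i < j
    · simp only [hij, if_true, true_and]
      split_ifs <;> ring
    · simp [hij]
  simp only [hsplit, Finset.sum_add_distrib, Finset.sum_sub_distrib]
  -- T1: (x, μ) = (z, i)  ⇔  z = x ∧ i = μ
  have T1 : ∑ z ∈ B, ∑ i : Fin 4, ∑ j : Fin 4, (if i < j ∧ (x, μ) = (z, i) then S z i j else 0) =
      ∑ ν : Fin 4, if μ < ν then S x μ ν else 0 := by
    rw [Finset.sum_eq_single_of_mem x hx]
    · rw [Finset.sum_eq_single_of_mem μ (Finset.mem_univ _)]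
      · exact Finset.sum_congr rfl fun j _ => by simp
      · intro i _ hi
        exact Finset.sum_eq_zero fun j _ => by
          rw [if_neg]; rintro ⟨-, h⟩; exact hi (Prod.mk.injEq _ _ _ _ ▸ h).2.symm
    · intro z _ hz
      exact Finset.sum_eq_zero fun i _ => Finset.sum_eq_zero fun j _ => by
        rw [if_neg]; rintro ⟨-, h⟩; exact hz (Prod.mk.injEq _ _ _ _ ▸ h).1.symm
  -- T2: (x, μ) = (z + e_i, j)  ⇔  j = μ ∧ z = x − e_i
  have T2 : ∑ z ∈ B, ∑ i : Fin 4, ∑ j : Fin 4, (if i < j ∧ (x, μ) = (z + Pi.single i 1, j) then S z i j else 0) =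
      ∑ ν : Fin 4, if ν < μ then S (x - Pi.single ν 1) ν μ else 0 := by
    rw [Finset.sum_comm]
    refine Finset.sum_congr rfl fun i _ => ?_
    rw [Finset.sum_eq_single_of_mem (x - Pi.single i 1) (hxν i)]
    · rw [Finset.sum_eq_single_of_mem μ (Finset.mem_univ _)]
      · simp
      · intro j _ hj
        rw [if_neg]; rintro ⟨-, h⟩; exact hj (Prod.mk.injEq _ _ _ _ ▸ h).2.symm
    · intro z _ hz
      exact Finset.sum_eq_zero fun j _ => by
        rw [if_neg]; rintro ⟨-, h⟩
        apply hz
        have h1 : x = z + Pi.single i 1 := (Prod.mk.injEq _ _ _ _ ▸ h).1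
        rw [h1]; simp
  -- T3: (x, μ) = (z + e_j, i)  ⇔  i = μ ∧ z = x − e_j
  have T3 : ∑ z ∈ B, ∑ i : Fin 4, ∑ j : Fin 4, (if i < j ∧ (x, μ) = (z + Pi.single j 1, i) then S z i j else 0) =
      ∑ ν : Fin 4, if μ < ν then S (x - Pi.single ν 1) μ ν else 0 := by
    rw [Finset.sum_comm]
    rw [Finset.sum_eq_single_of_mem μ (Finset.mem_univ _)]
    · rw [Finset.sum_comm]
      refine Finset.sum_congr rfl fun j _ => ?_
      rw [Finset.sum_eq_single_of_mem (x - Pi.single j 1) (hxν j)]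
      · simp
      · intro z _ hz
        rw [if_neg]; rintro ⟨-, h⟩
        apply hz
        have h1 : x = z + Pi.single j 1 := (Prod.mk.injEq _ _ _ _ ▸ h).1
        rw [h1]; simp
    · intro i _ hi
      exact Finset.sum_eq_zero fun z _ => Finset.sum_eq_zero fun j _ => by
        rw [if_neg]; rintro ⟨-, h⟩; exact hi (Prod.mk.injEq _ _ _ _ ▸ h).2.symm
  -- T4: (x, μ) = (z, j)  ⇔  z = x ∧ j = μ
  have T4 : ∑ z ∈ B, ∑ i : Fin 4, ∑ j : Fin 4, (if i < j ∧ (x, μ) = (z, j) then S z i j else 0) =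
      ∑ ν : Fin 4, if ν < μ then S x ν μ else 0 := by
    rw [Finset.sum_eq_single_of_mem x hx]
    · refine Finset.sum_congr rfl fun i _ => ?_
      rw [Finset.sum_eq_single_of_mem μ (Finset.mem_univ _)]
      · simp
      · intro j _ hj
        rw [if_neg]; rintro ⟨-, h⟩; exact hj (Prod.mk.injEq _ _ _ _ ▸ h).2.symm
    · intro z _ hz
      exact Finset.sum_eq_zero fun i _ => Finset.sum_eq_zero fun j _ => by
        rw [if_neg]; rintro ⟨-, h⟩; exact hz (Prod.mk.injEq _ _ _ _ ▸ h).1.symm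
  rw [T1, T2, T3, T4]
  -- regroup: (T1 + T2) - T3 - T4 = (T1 - T3) + (T2 - T4)
  have hre : ∀ a b c d : ℝ, a + b - c - d = (a - c) + (b - d) := fun a b c d => by ring
  rw [hre, ← Finset.sum_sub_distrib, ← Finset.sum_sub_distrib]
  congr 1
  · exact Finset.sum_congr rfl fun ν _ => by split_ifs <;> ring
  · exact Finset.sum_congr rfl fun ν _ => by split_ifs <;> ring

/-! ## The rows of `hodgeQ` -/

/-- A free edge is a cold-box edge: coordinates of its base point and direction. -/
theorem free_mem_boxEdges (e : LandauFree H) : e.1.1 ∈ boxEdges 4 (2 * H + 1) := by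
  have h := e.2
  simp only [landauPin, not_not] at h
  exact h

/-- **The row of `hodgeQ` at a free edge `e = (x, μ)`** (general form): the six plaquettes through `e` (two per transverse direction `ν`,
based at `x` and at `x − e_ν`, with the signs of `coeffAux`) and the gauge modes of the two endpoints, the latter only when the endpoint is an
INTERIOR site.  Here `ū = glue 0 w` is the zero extension and `div ū(y) = Σ_i (ū(y − e_i, i) − ū(y, i))`. -/
theorem hodgeQ_mulVec_apply (w : LandauFree H → ℝ) (e : LandauFree H)
    (u : Literature.MathematicalPhysics.QuantumLattice.ZdEdge 4 → ℝ) (hu : u = glue (pin := landauPin H) dirCorner (2 * H + 3) 0 w) :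
    (hodgeQ H *ᵥ w) e =
      ((∑ ν : Fin 4, if e.1.1.2 < ν then
          (u (e.1.1.1, e.1.1.2) + u (e.1.1.1 + Pi.single e.1.1.2 1, ν) - u (e.1.1.1 + Pi.single ν 1, e.1.1.2) - u (e.1.1.1, ν)) -
          (u (e.1.1.1 - Pi.single ν 1, e.1.1.2) + u (e.1.1.1 - Pi.single ν 1 + Pi.single e.1.1.2 1, ν) -
            u (e.1.1.1 - Pi.single ν 1 + Pi.single ν 1, e.1.1.2) - u (e.1.1.1 - Pi.single ν 1, ν)) else 0) +
        ∑ ν : Fin 4, if ν < e.1.1.2 then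
          (u (e.1.1.1 - Pi.single ν 1, ν) + u (e.1.1.1 - Pi.single ν 1 + Pi.single ν 1, e.1.1.2) -
            u (e.1.1.1 - Pi.single ν 1 + Pi.single e.1.1.2 1, ν) - u (e.1.1.1 - Pi.single ν 1, e.1.1.2)) -
          (u (e.1.1.1, ν) + u (e.1.1.1 + Pi.single ν 1, e.1.1.2) - u (e.1.1.1 + Pi.single e.1.1.2 1, ν) - u (e.1.1.1, e.1.1.2)) else 0) +
      ((if e.1.1.1 + Pi.single e.1.1.2 1 ∈ interiorSites H then
          ∑ i : Fin 4, (u (e.1.1.1 + Pi.single e.1.1.2 1 - Pi.single i 1, i) - u (e.1.1.1 + Pi.single e.1.1.2 1, i)) else 0) -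
        (if e.1.1.1 ∈ interiorSites H then ∑ i : Fin 4, (u (e.1.1.1 - Pi.single i 1, i) - u (e.1.1.1, i)) else 0)) := by
  classical
  -- the row as a bilinear pairing with the indicator of `e`
  have hrow : (hodgeQ H *ᵥ w) e = Pi.single e (1 : ℝ) ⬝ᵥ (hodgeQ H *ᵥ w) := (single_one_dotProduct e _).symm
  rw [hrow, dotProduct_hodgeQ_mulVec]
  have hlam : ∀ p : Plaq 4, landauCoeff H p ⬝ᵥ Pi.single e (1 : ℝ) = landauCoeff H p e := fun p => dotProduct_single_one _ _
  have hg : ∀ y : Site 4, gradVec H y ⬝ᵥ Pi.single e (1 : ℝ) = gradVec H y e := fun y => dotProduct_single_one _ _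
  simp only [hlam, hg]
  -- plaquette part
  have hmem := free_mem_boxEdges e
  have hE : e.1.1 = (e.1.1.1, e.1.1.2) := rfl
  rw [hE, mem_boxEdges_iff] at hmem
  have hxB : e.1.1.1 ∈ Fintype.piFinset (fun _ : Fin 4 => Finset.Icc (-2 : ℤ) (((2 * H : ℕ) : ℤ) + 2)) := by
    rw [mem_box]; intro k; have := hmem.1 k; push_cast at this ⊢; constructor <;> omega
  have hxνB : ∀ ν : Fin 4, e.1.1.1 - Pi.single ν 1 ∈ Fintype.piFinset (fun _ : Fin 4 => Finset.Icc (-2 : ℤ) (((2 * H : ℕ) : ℤ) + 2)) := by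
    intro ν; rw [mem_box]; intro k
    have := hmem.1 k
    have hs := HodgePoincare.single_one_apply_bounds ν k
    simp only [Pi.sub_apply]; push_cast at this ⊢; constructor <;> omega
  have hcol := boxSum_coeffAux_collapse _ e.1.1.1 e.1.1.2 hxB hxνB
    (fun z i j => u (z, i) + u (z + Pi.single i 1, j) - u (z + Pi.single j 1, i) - u (z, j))
  simp only [Prod.mk.eta] at hcol
  rw [sum_hodgePlaqs_row_eq_boxSum w e u hu, hcol]
  -- gauge part
  have hgauge : ∑ y ∈ interiorSites H, gradVec H y e * (gradVec H y ⬝ᵥ w) =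
      (if e.1.1.1 + Pi.single e.1.1.2 1 ∈ interiorSites H then
          ∑ i : Fin 4, (u (e.1.1.1 + Pi.single e.1.1.2 1 - Pi.single i 1, i) - u (e.1.1.1 + Pi.single e.1.1.2 1, i)) else 0) -
        (if e.1.1.1 ∈ interiorSites H then ∑ i : Fin 4, (u (e.1.1.1 - Pi.single i 1, i) - u (e.1.1.1, i)) else 0) := by
    have hgy : ∀ y : Site 4, gradVec H y e * (gradVec H y ⬝ᵥ w) =
        (if e.1.1.1 + Pi.single e.1.1.2 1 = y then gradVec H y ⬝ᵥ w else 0) - (if e.1.1.1 = y then gradVec H y ⬝ᵥ w else 0) := by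
      intro y; simp only [gradVec]; split_ifs <;> ring
    simp only [hgy, Finset.sum_sub_distrib, Finset.sum_ite_eq]
    by_cases h1 : e.1.1.1 + Pi.single e.1.1.2 1 ∈ interiorSites H <;>
      by_cases h2 : e.1.1.1 ∈ interiorSites H <;>
        simp only [h1, h2, if_true, if_false, gradVec_dotProduct_eq, hu, Finset.sum_sub_distrib]
  rw [hgauge]

/-- **T-U1.0 (planner ym-idea-2, STUB-PLAN-U1 §0): the BULK rows of `hodgeQ` are the componentwise 8-neighbour scalar Laplacian.**
If both endpoints of the free edge `e = (x, μ)` are interior sites, then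
`(hodgeQ w)(e) = 8·w(e) − Σ_ν (ū(x + e_ν, μ) + ū(x − e_ν, μ))` (`ū = glue 0 w` the zero extension; the `ν = μ` summand carries the two
longitudinal neighbours, `ν ≠ μ` the six transverse ones): the mixed curl terms cancel against the endpoint divergence terms (lattice
Weitzenböck identity). -/
theorem hodgeQ_mulVec_apply_bulk (w : LandauFree H → ℝ) (e : LandauFree H)
    (u : Literature.MathematicalPhysics.QuantumLattice.ZdEdge 4 → ℝ) (hu : u = glue (pin := landauPin H) dirCorner (2 * H + 3) 0 w)
    (hx : e.1.1.1 ∈ interiorSites H) (hxμ : e.1.1.1 + Pi.single e.1.1.2 1 ∈ interiorSites H) :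
    (hodgeQ H *ᵥ w) e = 8 * w e - ∑ ν : Fin 4, (u (e.1.1.1 + Pi.single ν 1, e.1.1.2) + u (e.1.1.1 - Pi.single ν 1, e.1.1.2)) := by
  rw [hodgeQ_mulVec_apply w e u hu, if_pos hxμ, if_pos hx]
  set x := e.1.1.1 with hxdef
  set μ := e.1.1.2 with hμdef
  have hwe : u (x, μ) = w e := by
    rw [hu]
    exact glue_apply_free (pin := landauPin H) 0 w e
  -- everything as one sum over `ν`, compared termwise
  have h8 : 8 * w e - ∑ ν : Fin 4, (u (x + Pi.single ν 1, μ) + u (x - Pi.single ν 1, μ)) =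
      ∑ ν : Fin 4, (2 * w e - (u (x + Pi.single ν 1, μ) + u (x - Pi.single ν 1, μ))) := by
    rw [Finset.sum_sub_distrib, Finset.sum_const, Finset.card_univ, Fintype.card_fin]
    simp only [nsmul_eq_mul]
    ring
  rw [h8, ← Finset.sum_sub_distrib, ← Finset.sum_add_distrib, ← Finset.sum_add_distrib]
  refine Finset.sum_congr rfl fun ν _ => ?_
  have h1 : x - Pi.single ν 1 + Pi.single ν 1 = x := sub_add_cancel x _
  have h2 : x - Pi.single ν 1 + Pi.single μ 1 = x + Pi.single μ 1 - Pi.single ν 1 := by abel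
  have h3 : x + Pi.single μ 1 - Pi.single μ 1 = x := add_sub_cancel_right x _
  rw [h1, h2]
  rcases lt_trichotomy μ ν with hlt | heq | hgt
  · rw [if_pos hlt, if_neg (not_lt.2 hlt.le), ← hwe]
    ring
  · subst heq
    rw [if_neg (lt_irrefl _), if_neg (lt_irrefl _), h3, ← hwe]
    ring
  · rw [if_neg (not_lt.2 hgt.le), if_pos hgt, ← hwe]
    ring

end Summit.QuantumFields.YangMills.Theorems.AllWindowsColdBoxBoxHighLine

end
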